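/-
Copyright (c) 2026 the pub-hodgecm-mathlib formalisation cell (harness21).  Prover seat hodgecm-mathlib-K2Liu-p09 (g9), Track B «K2-LIT» ∕ hLiu418
#184♮, #42S BLOCK D row D-2, (σ-A) brick (an-3c) §3b piece (B1) sequel «the graph reading at the ζ-stage corner prefix» (road desk K2Liu-p25 (g3)
WORDS #51, #53; consumer K2Liu-p08 (g6) piece (A)), 2026-09-05.  THEOREMS ONLY.
-/
import Summits.HodgeConjecture.HodgeConjecture.Theorems.K2LiuConeGraphReadingOperator   -- (B1) §0–§1: Siegel-Levi products, the operator layer (this seat)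
import HarnessLib

/-!
# Crux `HLiu418`, #42S block D row D-2, (σ-A) brick (an-3c) §3b (B1) sequel: THE GRAPH READING AT THE ζ-STAGE CORNER PREFIX
# `p(z) = (w₁ · φ(w₂)) · φ(w₁′) · φ(u⁻(z))` — Siegel-Levi, `z`-FREE Siegel character value, and the operator layer at `p(z)`

Cell `hodgecm-mathlib`, crux item hLiu418 = `stmt-HodgeConjecture-24832`; squad K2 ∕ K2Liu; helper lane `--supports stmt-HodgeConjecture-24832 --as helper`,
count-neutral.  THEOREMS ONLY (no `def`, no `instance`, no `notation`, no named-fact hypothesis, no `sorry`).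

WHY.  ★ (B1) `K2LiuConeGraphReadingOperator.exists_levi_letter_toOp_boxLoc_localSplitting_tensorEmbLoc_apply` reads the conjugate
`op(j̃) ∘ frameOp⁻¹ ∘ ω(s′(p₀ ⊗ 1)) ∘ frameOp ∘ op(j̃)⁻¹` of ANY small Siegel-Levi `p₀` as `(χ_v⁻¹(det_Δ p₀)^{M₂})⁻¹ · |det B|^{-1/2} · Ψ(P̂D⁻¹ B⁻¹ P̂D ·)`.  K2Liu-p08
(g6)'s (an-3c) §3b (A) needs it at the ζ-stage corner prefix `p(z) = (w₁ · φ(w₂)) · φ(w₁′) · φ(u⁻(z))` of ★ `chainValues_of_placeLetter` (e′) with a `z`-FREE scalar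
(`cF′`).  THIS FILE:
* **`cornerPrefix_levi`** — `q := (w₁ · φ(w₂)) · φ(w₁′)` and `p(z) = q · φ(u⁻(z))` are Siegel-LEVI (`B = 0 = C`) with `A(p(z)) = A(q) · (1 z; 0 1)` (★ [A1-mat]
  `isSiegelDelta_flip_mul_frameConj_weylTwo`, ★ p864439 (Y1), ★ B1b-2d `blocks_matA_frameConj_weylOne ∕ uMinus`, ★ (B1) §0 `levi_mul_blocks`);
* **`blkD_cornerPrefix`** — the `Δ⁻`-blocks `D(q)`, `D(p(z)) = D(q) · D_v (1 −σz; 0 1) Dinv_v` EXPLICIT (acting-desk K2Liu-p12 (g6) WORD #1: the point reading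
  of (B2-coord) lives on the `Δ⁻`-coordinate);
* **`chiDet_cornerPrefix`** — `χ_v(det_Δ p(z)) = χ_v(det_Δ q)` for every family of local characters (★ `detDelta_levi`, `det (1 z; 0 1) = 1`);
* **`exists_levi_letter_cornerPrefix_apply`** — ★ (B1) §1 at `p₀ := p(z)` with the scalar `(χ_v⁻¹(det_Δ q)^{M₂})⁻¹` — `z`-free; the remaining `z`-dependence
  sits in the Levi letter `B = B_z` alone, whose point action `P̂D⁻¹ B_z⁻¹ P̂D (x₁ ⊔ 0) = Z_{x₁} ζ′ ⊔ λ·x₁` and `|det B_z| = const` are (B2-coord) (K2Liu-p12 (g6)).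
HONEST LABEL.  Count-neutral helper: `HC_CM` is proved only modulo the 7 printed citations (2 remaining named inputs: hLiu418 = `stmt-HodgeConjecture-24832`,
h413 = `stmt-HodgeConjecture-24833`) until rung 0 closes.

## References
* [Kudla1994] S. S. Kudla, Israel J. Math. 87 (1994), §3, Thm. 3.1.   * [Rangarao1993] R. Ranga Rao, Pacific J. Math. 157 (1993), Lemma 3.2 (3.8), p. 351.
* [MoeglinVignerasWaldspurger1987] LNM 1291 (1987), Chap. 2 I.7, II.1 Rem. (3), (6), II.2, II.6.   * [HarrisKudlaSweet1996] J. AMS 9 (1996), §1 (1.11)–(1.12), (1.15)–(1.16).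
* [Casselman1980] W. Casselman, Compositio Math. 40 (1980), §3.   * [Rogawski1990] J. Rogawski, Ann. of Math. Studies 123 (1990), §1.9.
-/

set_option autoImplicit false
-- the mandated namespace repeats the single-problem summit's segment (`HodgeConjecture.HodgeConjecture`)
set_option linter.dupNamespace false

noncomputable section

open scoped Matrix Kronecker
open NumberField IsDedekindDomain MeasureTheory Matrix
open Literature.RepresentationTheory.HeisenbergGroup Literature.RepresentationTheory.HeisenbergGroup.SymplecticMatrix
open Literature.NumberTheory.Automorphic Literature.NumberTheory.Automorphic.UnitaryGroup Literature.NumberTheory.Weil1964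
open Literature.NumberTheory.GaloisRepresentations Literature.NumberTheory.GaloisRepresentations.IsNonarchimedeanLocalField
open Literature.RepresentationTheory.HarrisKudlaSweet1996
open Literature.NumberTheory.GelbartRogawski1991 Literature.NumberTheory.GelbartRogawski1991.GRConstruction
open Literature.NumberTheory.GelbartRogawski1991.AdaptedBlocks
open Literature.NumberTheory.GelbartRogawski1991.UnitaryDualPair
open Literature.NumberTheory.GelbartRogawski1991.UnitaryDualPair.LocalSplitting
open Literature.NumberTheory.GelbartRogawski1991.UnitaryDualPair.LocalSplitting.FrameTransport
open Literature.NumberTheory.GelbartRogawski1991.UnitaryDualPair.LocalSplitting.DoubledBlock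
open Literature.NumberTheory.K2Lit.SiegelDoubled Literature.NumberTheory.K2Lit.LocalSiegelDoubled
open Summit.HodgeConjecture.HodgeConjecture.Cruxes.HLiu418.K2LiuLocalSWSectionDefs
open Summit.HodgeConjecture.HodgeConjecture.Cruxes.HLiu418.K2LiuLocalSWTensorAdaptedBlocks
open Summit.HodgeConjecture.HodgeConjecture.Cruxes.HLiu418.K2LiuLocalSiegelIwasawa (antidiagonal_over_eq_map)
open Summit.HodgeConjecture.HodgeConjecture.Cruxes.HLiu418.K2LiuDoubledUTwoTwoBorelFrame (uMinus)
open Summit.HodgeConjecture.HodgeConjecture.Cruxes.HLiu418.K2LiuDoubledUTwoTwoWeylCocycle (weylOne weylTwo)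
open Summit.HodgeConjecture.HodgeConjecture.Cruxes.HLiu418.K2LiuDoubledUTwoTwoFrameTransport (toLocalFour)
open Summit.HodgeConjecture.HodgeConjecture.Cruxes.HLiu418.K2LiuDoubledUTwoTwoLetterTransport (blocks_matA_frameConj_weylOne blocks_matA_frameConj_uMinus)
open Summit.HodgeConjecture.HodgeConjecture.Cruxes.HLiu418.K2LiuLocalFourCornerFactorisation (isSiegelDelta_flip_mul_frameConj_weylTwo)
open Summit.HodgeConjecture.HodgeConjecture.Cruxes.HLiu418.K2LiuLocalSWCornerActionWordsYStage (fromBlocks_one_sub_single_one blkC_matA_flip_mul_frameConj_weylTwo)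
open Summit.HodgeConjecture.HodgeConjecture.Cruxes.HLiu418.K2LiuSiegelLeviWeylAlgebra (detDelta_levi)
open Summit.HodgeConjecture.HodgeConjecture.Cruxes.HLiu418.K2LiuTensorMiddleCellHaarDelta (toOp_boxLoc_frameOp_symm)
open Summit.HodgeConjecture.HodgeConjecture.Cruxes.HLiu418.K2LiuLocalSWCornerActionWordsZeta (toOp_localOmega_tensorEmbLoc_eq_smul_leviOpPi)
open Summit.HodgeConjecture.HodgeConjecture.Cruxes.HLiu418.K2LiuLocalSWCornerImplementerLetters (exists_hB_tensorEmbLoc)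
open Summit.HodgeConjecture.HodgeConjecture.Cruxes.HLiu418.K2LiuConeGraphReadingOperator

namespace Summit.HodgeConjecture.HodgeConjecture.Cruxes.HLiu418.K2LiuConeGraphReadingCornerPrefix


variable (L : Type) [Field L] [NumberField L] [IsCMField L]
variable {N M : ℕ} (e : Fin N × Fin M ≃ Fin 2)
  (dV : Fin N → L) (hdV : ∀ i, IsCMField.complexConj L (dV i) = dV i)
  (dW : Fin M → L) (hdW : ∀ i, IsCMField.complexConj L (dW i) = dW i)
variable {M₂ M' : ℕ} (eW : Fin M × Fin M₂ ≃ Fin M') (e' : Fin N × Fin M' ≃ Fin (M₂ + M₂))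
  (dV' : Fin M₂ → L) (hdV' : ∀ k, IsCMField.complexConj L (dV' k) = dV' k)
  (v : HeightOneSpectrum (𝓞 (Fp L)))
  [MeasurableSpace (v.adicCompletion (Fp L))] [BorelSpace (v.adicCompletion (Fp L))]
  (μ : Measure (v.adicCompletion (Fp L))) [μ.IsAddHaarMeasure]
  (χ : HeckeCharacter L) (hχ : IsSplittingChar L 1 χ)

variable {σ : Equiv.Perm (Fin (M₂ + M₂))} {T₁ T₂ : Matrix (Fin M₂) (Fin M₂) (Fp L)}
  (P : GL (Fin (M₂ + M₂)) (Fp L)) (hPσ : (P : Matrix (Fin (M₂ + M₂)) (Fin (M₂ + M₂)) (Fp L)) = σ.toPEquiv.toMatrix)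
  (hP : ((P : Matrix (Fin (M₂ + M₂)) (Fin (M₂ + M₂)) (Fp L)))ᵀ *
      gramR L e' dV hdV (tensorFrame L dW eW dV') (tensorFrame_real L dW hdW eW dV' hdV') * (P : Matrix _ _ (Fp L)) =
    UnitaryGroup.finSum M₂ M₂ T₁ T₂)
  {PD : GL (Fin ((M₂ + M₂) + (M₂ + M₂))) (Fp L)} (hPD : PD = UnitaryGroup.reindexGL (e₂ (M₂ + M₂)) (UnitaryGroup.blockDiagGL (P, P)))
  (hT₁ : T₁.IsSymm) (hT₂ : T₂.IsSymm)
  (hT₀d : IsUnit (gramR L e' dV hdV (tensorFrame L dW eW dV') (tensorFrame_real L dW hdW eW dV' hdV')).det)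
  (hTv' : IsUnit (localGram (Fp L) ((M₂ + M₂) + (M₂ + M₂)) (gramD (Fp L) (M₂ + M₂) (UnitaryGroup.finSum M₂ M₂ T₁ T₂)) v).det)
  (hTv₁ : IsUnit (localGram (Fp L) (M₂ + M₂) (gramD (Fp L) M₂ T₁) v).det)
  (hTv₂ : IsUnit (localGram (Fp L) (M₂ + M₂) (gramD (Fp L) M₂ T₂) v).det)
  -- Cayley-type block movers (★ GR91 `exists_mover_conj_iotaD_weylDelta` + ★ `MpPsi.proj_surjective`; the EXPLICIT pair in (B2-coord))
  (p₁ : LocalMp (Fp L) (M₂ + M₂) (gramD (Fp L) M₂ T₁) v)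
  (hp₁ : (deltaLagrangian (Fp L) v M₂).map (toLin (Fp L) v (MpPsi.proj _ p₁)) = lagrangianY (Fp L) (M₂ + M₂) v)
  (B₁ : GL (Fin (M₂ + M₂)) (v.adicCompletion (Fp L)))
  (hW₁ : MpPsi.proj _ p₁ * iotaD (Fp L) L (IsCMField.complexConj L) (complexConj_imagUnit L) (imagUnit_ne_zero L)
      (imagUnit_mul_self L) v M₂ hT₁ rfl (weylDelta (Fp L) L (IsCMField.complexConj L) v M₂ (T₀ := T₁) rfl) * (MpPsi.proj _ p₁)⁻¹ =
    (transportSp (localGram (Fp L) (M₂ + M₂) (gramD (Fp L) M₂ T₁) v) hTv₁ (SymplecticGroup.symJ _ _))⁻¹ *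
      transportSp (localGram (Fp L) (M₂ + M₂) (gramD (Fp L) M₂ T₁) v) hTv₁ (levi B₁))
  (p₂ : LocalMp (Fp L) (M₂ + M₂) (gramD (Fp L) M₂ T₂) v)
  (hp₂ : (deltaLagrangian (Fp L) v M₂).map (toLin (Fp L) v (MpPsi.proj _ p₂)) = lagrangianY (Fp L) (M₂ + M₂) v)
  (B₂ : GL (Fin (M₂ + M₂)) (v.adicCompletion (Fp L)))
  (hW₂ : MpPsi.proj _ p₂ * iotaD (Fp L) L (IsCMField.complexConj L) (complexConj_imagUnit L) (imagUnit_ne_zero L)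
      (imagUnit_mul_self L) v M₂ hT₂ rfl (weylDelta (Fp L) L (IsCMField.complexConj L) v M₂ (T₀ := T₂) rfl) * (MpPsi.proj _ p₂)⁻¹ =
    (transportSp (localGram (Fp L) (M₂ + M₂) (gramD (Fp L) M₂ T₂) v) hTv₂ (SymplecticGroup.symJ _ _))⁻¹ *
      transportSp (localGram (Fp L) (M₂ + M₂) (gramD (Fp L) M₂ T₂) v) hTv₂ (levi B₂))


/-! ## §1 The ζ-stage corner prefix `p(z) = (w₁ · φ(w₂)) · (φ(w₁′) · φ(u⁻(z)))`: Siegel-Levi, with a `z`-FREE Siegel character value -/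

variable (D Dinv : Matrix (Fin 2) (Fin 2) (Fp L)) (hDD : D * Dinv = 1) (Q : GL (Fin (2 + 2)) (Fp L))
  (hQm : (Q : Matrix (Fin (2 + 2)) (Fin (2 + 2)) (Fp L)) = Matrix.reindex (e₂ 2) (e₂ 2) (Matrix.fromBlocks 1 D 1 (-D)))
  (hQ : (Q : Matrix (Fin (2 + 2)) (Fin (2 + 2)) (Fp L))ᵀ * gramD (Fp L) 2 (gramR L e dV hdV dW hdW) * (Q : Matrix (Fin (2 + 2)) (Fin (2 + 2)) (Fp L)) =
    (StdForm.antidiagonal (2 + 2)).over (Fp L))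
  {d₁ d₂ d₁' d₂' : Fp L} (hDa : D = !![0, d₁; d₂, 0]) (hDia : Dinv = !![0, d₁'; d₂', 0])
  {w₁ : UnitaryGroup.localPi L (IsCMField.complexConj L) (2 + 2) (hermD L e dV hdV dW hdW) v}
  (hw₁ : adapt (matA (Fp L) L (IsCMField.complexConj L) v 2 w₁) =
    Matrix.fromBlocks (1 - Matrix.single 1 1 1) (Matrix.single 1 1 1) (Matrix.single 1 1 1) (1 - Matrix.single 1 1 1))

set_option maxHeartbeats 1600000 in -- MEASURED: 200000 RED (`isDefEq` while elaborating the four-letter products); ★ p864771's class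
omit [MeasurableSpace (v.adicCompletion (Fp L))] [BorelSpace (v.adicCompletion (Fp L))] in
include hDD hQm hDa hDia hw₁ in
/-- **the corner prefix is Siegel-LEVI with `z`-free `A`-determinant**: for `q := (w₁ · φ(w₂)) · φ(w₁′)` and `p(z) := q · φ(u⁻(z))`,
`B(q) = 0 = C(q)`, `B(p(z)) = 0 = C(p(z))` and `A(p(z)) = A(q) · (1 z; 0 1)` (★ [A1-mat] `isSiegelDelta_flip_mul_frameConj_weylTwo`, ★ p864439 (Y1), ★ B1b-2d
`blocks_matA_frameConj_weylOne ∕ uMinus`, §0 `levi_mul_blocks`). [cite: HarrisKudlaSweet1996, §1 (1.11)–(1.12)] [cite: Kudla1994, §3] -/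
theorem cornerPrefix_levi (z : UnitaryGroup.LocalRing L v) :
    (blkB (matA (Fp L) L (IsCMField.complexConj L) v 2 (w₁ *
        FrameTransport.frameConj (Fp L) L (IsCMField.complexConj L) v (2 + 2) (hermD_eq_map_gramD L e dV hdV dW hdW) (antidiagonal_over_eq_map (Fp L) L 2) Q hQ
          (toLocalFour (Fp L) L (IsCMField.complexConj L) v (weylTwo (UnitaryGroup.LocalRing L v) (UnitaryGroup.conjLocal L (IsCMField.complexConj L) v))) *
        FrameTransport.frameConj (Fp L) L (IsCMField.complexConj L) v (2 + 2) (hermD_eq_map_gramD L e dV hdV dW hdW) (antidiagonal_over_eq_map (Fp L) L 2) Q hQ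
          (toLocalFour (Fp L) L (IsCMField.complexConj L) v (weylOne (UnitaryGroup.LocalRing L v) (UnitaryGroup.conjLocal L (IsCMField.complexConj L) v))))) = 0 ∧
      blkC (matA (Fp L) L (IsCMField.complexConj L) v 2 (w₁ *
        FrameTransport.frameConj (Fp L) L (IsCMField.complexConj L) v (2 + 2) (hermD_eq_map_gramD L e dV hdV dW hdW) (antidiagonal_over_eq_map (Fp L) L 2) Q hQ
          (toLocalFour (Fp L) L (IsCMField.complexConj L) v (weylTwo (UnitaryGroup.LocalRing L v) (UnitaryGroup.conjLocal L (IsCMField.complexConj L) v))) *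
        FrameTransport.frameConj (Fp L) L (IsCMField.complexConj L) v (2 + 2) (hermD_eq_map_gramD L e dV hdV dW hdW) (antidiagonal_over_eq_map (Fp L) L 2) Q hQ
          (toLocalFour (Fp L) L (IsCMField.complexConj L) v (weylOne (UnitaryGroup.LocalRing L v) (UnitaryGroup.conjLocal L (IsCMField.complexConj L) v))))) = 0) ∧
    (blkB (matA (Fp L) L (IsCMField.complexConj L) v 2 (w₁ *
        FrameTransport.frameConj (Fp L) L (IsCMField.complexConj L) v (2 + 2) (hermD_eq_map_gramD L e dV hdV dW hdW) (antidiagonal_over_eq_map (Fp L) L 2) Q hQ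
          (toLocalFour (Fp L) L (IsCMField.complexConj L) v (weylTwo (UnitaryGroup.LocalRing L v) (UnitaryGroup.conjLocal L (IsCMField.complexConj L) v))) *
        FrameTransport.frameConj (Fp L) L (IsCMField.complexConj L) v (2 + 2) (hermD_eq_map_gramD L e dV hdV dW hdW) (antidiagonal_over_eq_map (Fp L) L 2) Q hQ
          (toLocalFour (Fp L) L (IsCMField.complexConj L) v (weylOne (UnitaryGroup.LocalRing L v) (UnitaryGroup.conjLocal L (IsCMField.complexConj L) v))) *
        FrameTransport.frameConj (Fp L) L (IsCMField.complexConj L) v (2 + 2) (hermD_eq_map_gramD L e dV hdV dW hdW) (antidiagonal_over_eq_map (Fp L) L 2) Q hQ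
          (toLocalFour (Fp L) L (IsCMField.complexConj L) v
            (uMinus (UnitaryGroup.LocalRing L v) (UnitaryGroup.conjLocal L (IsCMField.complexConj L) v)
              (UnitaryGroup.conjLocal_conjLocal (IsCMField.complexConj L) v (complexConj_imagUnit L) (imagUnit_ne_zero L)) z)))) = 0 ∧
      blkC (matA (Fp L) L (IsCMField.complexConj L) v 2 (w₁ *
        FrameTransport.frameConj (Fp L) L (IsCMField.complexConj L) v (2 + 2) (hermD_eq_map_gramD L e dV hdV dW hdW) (antidiagonal_over_eq_map (Fp L) L 2) Q hQ
          (toLocalFour (Fp L) L (IsCMField.complexConj L) v (weylTwo (UnitaryGroup.LocalRing L v) (UnitaryGroup.conjLocal L (IsCMField.complexConj L) v))) *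
        FrameTransport.frameConj (Fp L) L (IsCMField.complexConj L) v (2 + 2) (hermD_eq_map_gramD L e dV hdV dW hdW) (antidiagonal_over_eq_map (Fp L) L 2) Q hQ
          (toLocalFour (Fp L) L (IsCMField.complexConj L) v (weylOne (UnitaryGroup.LocalRing L v) (UnitaryGroup.conjLocal L (IsCMField.complexConj L) v))) *
        FrameTransport.frameConj (Fp L) L (IsCMField.complexConj L) v (2 + 2) (hermD_eq_map_gramD L e dV hdV dW hdW) (antidiagonal_over_eq_map (Fp L) L 2) Q hQ
          (toLocalFour (Fp L) L (IsCMField.complexConj L) v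
            (uMinus (UnitaryGroup.LocalRing L v) (UnitaryGroup.conjLocal L (IsCMField.complexConj L) v)
              (UnitaryGroup.conjLocal_conjLocal (IsCMField.complexConj L) v (complexConj_imagUnit L) (imagUnit_ne_zero L)) z)))) = 0 ∧
      blkA (matA (Fp L) L (IsCMField.complexConj L) v 2 (w₁ *
        FrameTransport.frameConj (Fp L) L (IsCMField.complexConj L) v (2 + 2) (hermD_eq_map_gramD L e dV hdV dW hdW) (antidiagonal_over_eq_map (Fp L) L 2) Q hQ
          (toLocalFour (Fp L) L (IsCMField.complexConj L) v (weylTwo (UnitaryGroup.LocalRing L v) (UnitaryGroup.conjLocal L (IsCMField.complexConj L) v))) *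
        FrameTransport.frameConj (Fp L) L (IsCMField.complexConj L) v (2 + 2) (hermD_eq_map_gramD L e dV hdV dW hdW) (antidiagonal_over_eq_map (Fp L) L 2) Q hQ
          (toLocalFour (Fp L) L (IsCMField.complexConj L) v (weylOne (UnitaryGroup.LocalRing L v) (UnitaryGroup.conjLocal L (IsCMField.complexConj L) v))) *
        FrameTransport.frameConj (Fp L) L (IsCMField.complexConj L) v (2 + 2) (hermD_eq_map_gramD L e dV hdV dW hdW) (antidiagonal_over_eq_map (Fp L) L 2) Q hQ
          (toLocalFour (Fp L) L (IsCMField.complexConj L) v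
            (uMinus (UnitaryGroup.LocalRing L v) (UnitaryGroup.conjLocal L (IsCMField.complexConj L) v)
              (UnitaryGroup.conjLocal_conjLocal (IsCMField.complexConj L) v (complexConj_imagUnit L) (imagUnit_ne_zero L)) z)))) =
        blkA (matA (Fp L) L (IsCMField.complexConj L) v 2 (w₁ *
          FrameTransport.frameConj (Fp L) L (IsCMField.complexConj L) v (2 + 2) (hermD_eq_map_gramD L e dV hdV dW hdW) (antidiagonal_over_eq_map (Fp L) L 2) Q hQ
            (toLocalFour (Fp L) L (IsCMField.complexConj L) v (weylTwo (UnitaryGroup.LocalRing L v) (UnitaryGroup.conjLocal L (IsCMField.complexConj L) v))) *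
          FrameTransport.frameConj (Fp L) L (IsCMField.complexConj L) v (2 + 2) (hermD_eq_map_gramD L e dV hdV dW hdW) (antidiagonal_over_eq_map (Fp L) L 2) Q hQ
            (toLocalFour (Fp L) L (IsCMField.complexConj L) v (weylOne (UnitaryGroup.LocalRing L v) (UnitaryGroup.conjLocal L (IsCMField.complexConj L) v))))) *
          !![1, z; 0, 1]) := by
  haveI : Algebra.IsQuadraticExtension (Fp L) L := IsCMField.isQuadraticExtension L
  have hBm := (isSiegelDelta_flip_mul_frameConj_weylTwo (Fp L) L (IsCMField.complexConj L) (complexConj_imagUnit L) (imagUnit_ne_zero L)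
    (imagUnit_mul_self L) v (gramR_isSymm L e dV hdV dW hdW) (hermD_eq_map_gramD L e dV hdV dW hdW) D Dinv hDD Q hQm hQ hDa hDia w₁
    (hw₁.trans fromBlocks_one_sub_single_one)).2
  have hCm := blkC_matA_flip_mul_frameConj_weylTwo L e dV hdV dW hdW v D Dinv hDD Q hQm hQ hDa hDia hw₁
  obtain ⟨-, hBw, hCw⟩ := blocks_matA_frameConj_weylOne (Fp L) L (IsCMField.complexConj L) v (hermD_eq_map_gramD L e dV hdV dW hdW) D Dinv hDD Q hQm hQ
  obtain ⟨hAu, hBu, hCu⟩ := blocks_matA_frameConj_uMinus (Fp L) L (IsCMField.complexConj L) (complexConj_imagUnit L) (imagUnit_ne_zero L) v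
    (hermD_eq_map_gramD L e dV hdV dW hdW) D Dinv hDD Q hQm hQ z
  obtain ⟨-, hBq, hCq, -⟩ := levi_mul_blocks (Fp L) L (IsCMField.complexConj L) v 2 hBm hCm hBw hCw
  obtain ⟨hA, hB, hC, -⟩ := levi_mul_blocks (Fp L) L (IsCMField.complexConj L) v 2 hBq hCq hBu hCu
  exact ⟨⟨hBq, hCq⟩, hB, hC, hA.trans (by rw [hAu])⟩

set_option maxHeartbeats 1600000 in -- as above
omit [MeasurableSpace (v.adicCompletion (Fp L))] [BorelSpace (v.adicCompletion (Fp L))] in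
include hDD hQm hDa hDia hw₁ in
/-- **the Siegel character value of the corner prefix is `z`-FREE**: `χ_v(det_Δ((w₁·φ(w₂))·φ(w₁′)·φ(u⁻(z)))) = χ_v(det_Δ((w₁·φ(w₂))·φ(w₁′)))` — `det_Δ` of a
Levi element is `det A` (★ `detDelta_levi`), `A` is multiplicative on the Levi (§0) and `det (1 z; 0 1) = 1`. [cite: Kudla1994, §3 Thm. 3.1] [cite: HarrisKudlaSweet1996, §1 (1.15)] -/
theorem chiDet_cornerPrefix (χv : ∀ w' : PlacesOver L v, (w'.1.adicCompletion L)ˣ →* ℂˣ) (z : UnitaryGroup.LocalRing L v) :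
    LocalSplitting.chiDet (Fp L) L (IsCMField.complexConj L) v 2 χv (w₁ *
        FrameTransport.frameConj (Fp L) L (IsCMField.complexConj L) v (2 + 2) (hermD_eq_map_gramD L e dV hdV dW hdW) (antidiagonal_over_eq_map (Fp L) L 2) Q hQ
          (toLocalFour (Fp L) L (IsCMField.complexConj L) v (weylTwo (UnitaryGroup.LocalRing L v) (UnitaryGroup.conjLocal L (IsCMField.complexConj L) v))) *
        FrameTransport.frameConj (Fp L) L (IsCMField.complexConj L) v (2 + 2) (hermD_eq_map_gramD L e dV hdV dW hdW) (antidiagonal_over_eq_map (Fp L) L 2) Q hQ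
          (toLocalFour (Fp L) L (IsCMField.complexConj L) v (weylOne (UnitaryGroup.LocalRing L v) (UnitaryGroup.conjLocal L (IsCMField.complexConj L) v))) *
        FrameTransport.frameConj (Fp L) L (IsCMField.complexConj L) v (2 + 2) (hermD_eq_map_gramD L e dV hdV dW hdW) (antidiagonal_over_eq_map (Fp L) L 2) Q hQ
          (toLocalFour (Fp L) L (IsCMField.complexConj L) v
            (uMinus (UnitaryGroup.LocalRing L v) (UnitaryGroup.conjLocal L (IsCMField.complexConj L) v)
              (UnitaryGroup.conjLocal_conjLocal (IsCMField.complexConj L) v (complexConj_imagUnit L) (imagUnit_ne_zero L)) z))) =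
      LocalSplitting.chiDet (Fp L) L (IsCMField.complexConj L) v 2 χv (w₁ *
        FrameTransport.frameConj (Fp L) L (IsCMField.complexConj L) v (2 + 2) (hermD_eq_map_gramD L e dV hdV dW hdW) (antidiagonal_over_eq_map (Fp L) L 2) Q hQ
          (toLocalFour (Fp L) L (IsCMField.complexConj L) v (weylTwo (UnitaryGroup.LocalRing L v) (UnitaryGroup.conjLocal L (IsCMField.complexConj L) v))) *
        FrameTransport.frameConj (Fp L) L (IsCMField.complexConj L) v (2 + 2) (hermD_eq_map_gramD L e dV hdV dW hdW) (antidiagonal_over_eq_map (Fp L) L 2) Q hQ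
          (toLocalFour (Fp L) L (IsCMField.complexConj L) v (weylOne (UnitaryGroup.LocalRing L v) (UnitaryGroup.conjLocal L (IsCMField.complexConj L) v)))) := by
  obtain ⟨⟨-, hCq⟩, -, hC, hA⟩ := cornerPrefix_levi L e dV hdV dW hdW v D Dinv hDD Q hQm hQ hDa hDia hw₁ z
  have hdet : ∀ w' : PlacesOver L v,
      detDelta (Fp L) L (IsCMField.complexConj L) v 2 w' (w₁ *
        FrameTransport.frameConj (Fp L) L (IsCMField.complexConj L) v (2 + 2) (hermD_eq_map_gramD L e dV hdV dW hdW) (antidiagonal_over_eq_map (Fp L) L 2) Q hQ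
          (toLocalFour (Fp L) L (IsCMField.complexConj L) v (weylTwo (UnitaryGroup.LocalRing L v) (UnitaryGroup.conjLocal L (IsCMField.complexConj L) v))) *
        FrameTransport.frameConj (Fp L) L (IsCMField.complexConj L) v (2 + 2) (hermD_eq_map_gramD L e dV hdV dW hdW) (antidiagonal_over_eq_map (Fp L) L 2) Q hQ
          (toLocalFour (Fp L) L (IsCMField.complexConj L) v (weylOne (UnitaryGroup.LocalRing L v) (UnitaryGroup.conjLocal L (IsCMField.complexConj L) v))) *
        FrameTransport.frameConj (Fp L) L (IsCMField.complexConj L) v (2 + 2) (hermD_eq_map_gramD L e dV hdV dW hdW) (antidiagonal_over_eq_map (Fp L) L 2) Q hQ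
          (toLocalFour (Fp L) L (IsCMField.complexConj L) v
            (uMinus (UnitaryGroup.LocalRing L v) (UnitaryGroup.conjLocal L (IsCMField.complexConj L) v)
              (UnitaryGroup.conjLocal_conjLocal (IsCMField.complexConj L) v (complexConj_imagUnit L) (imagUnit_ne_zero L)) z))) =
      detDelta (Fp L) L (IsCMField.complexConj L) v 2 w' (w₁ *
        FrameTransport.frameConj (Fp L) L (IsCMField.complexConj L) v (2 + 2) (hermD_eq_map_gramD L e dV hdV dW hdW) (antidiagonal_over_eq_map (Fp L) L 2) Q hQ
          (toLocalFour (Fp L) L (IsCMField.complexConj L) v (weylTwo (UnitaryGroup.LocalRing L v) (UnitaryGroup.conjLocal L (IsCMField.complexConj L) v))) *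
        FrameTransport.frameConj (Fp L) L (IsCMField.complexConj L) v (2 + 2) (hermD_eq_map_gramD L e dV hdV dW hdW) (antidiagonal_over_eq_map (Fp L) L 2) Q hQ
          (toLocalFour (Fp L) L (IsCMField.complexConj L) v (weylOne (UnitaryGroup.LocalRing L v) (UnitaryGroup.conjLocal L (IsCMField.complexConj L) v)))) := by
    intro w'
    rw [detDelta_levi (Fp L) L (IsCMField.complexConj L) v 2 hC w', detDelta_levi (Fp L) L (IsCMField.complexConj L) v 2 hCq w', hA, Matrix.det_mul,
      Matrix.det_fin_two_of]
    simp
  unfold LocalSplitting.chiDet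
  exact Finset.prod_congr rfl fun w' _ => by rw [hdet w']


set_option maxHeartbeats 1600000 in -- as above
omit [MeasurableSpace (v.adicCompletion (Fp L))] [BorelSpace (v.adicCompletion (Fp L))] in
include hDD hQm hDa hDia hw₁ in
/-- **the `Δ⁻`-block of the corner prefix, EXPLICIT** (acting-desk WORD #1 ask: the point reading lives on the `Δ⁻`-coordinate, on which `matA` acts through `blkD`):
`D(p(z)) = D(q) · D(φ(u⁻(z)))` with `D(q) = (1 0; 0 ι d₁′) · (D_v W Dinv_v)`, `W = antidiag(1,1)` (★ [A1-mat] ED. 2 `blkA_blkD_flip_mul_frameConj_weylTwo`, ★ [A1-mat]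
`adapt_matA_frameConj_weylOne`) and `D(φ(u⁻(z))) = D_v (1 −σz; 0 1) Dinv_v` (★ [A1-mat] `adapt_matA_frameConj_uMinus`). [cite: HarrisKudlaSweet1996, §1 (1.11)–(1.12)] [cite: Kudla1994, §3] -/
theorem blkD_cornerPrefix (z : UnitaryGroup.LocalRing L v) :
    blkD (matA (Fp L) L (IsCMField.complexConj L) v 2 (w₁ *
        FrameTransport.frameConj (Fp L) L (IsCMField.complexConj L) v (2 + 2) (hermD_eq_map_gramD L e dV hdV dW hdW) (antidiagonal_over_eq_map (Fp L) L 2) Q hQ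
          (toLocalFour (Fp L) L (IsCMField.complexConj L) v (weylTwo (UnitaryGroup.LocalRing L v) (UnitaryGroup.conjLocal L (IsCMField.complexConj L) v))) *
        FrameTransport.frameConj (Fp L) L (IsCMField.complexConj L) v (2 + 2) (hermD_eq_map_gramD L e dV hdV dW hdW) (antidiagonal_over_eq_map (Fp L) L 2) Q hQ
          (toLocalFour (Fp L) L (IsCMField.complexConj L) v (weylOne (UnitaryGroup.LocalRing L v) (UnitaryGroup.conjLocal L (IsCMField.complexConj L) v))))) =
        !![1, 0; 0, (UnitaryGroup.toLocalRing L v).comp (algebraMap (Fp L) (v.adicCompletion (Fp L))) d₁'] *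
          (D.map ((UnitaryGroup.toLocalRing L v).comp (algebraMap (Fp L) (v.adicCompletion (Fp L)))) * !![0, 1; 1, 0] *
            Dinv.map ((UnitaryGroup.toLocalRing L v).comp (algebraMap (Fp L) (v.adicCompletion (Fp L))))) ∧
      blkD (matA (Fp L) L (IsCMField.complexConj L) v 2 (w₁ *
        FrameTransport.frameConj (Fp L) L (IsCMField.complexConj L) v (2 + 2) (hermD_eq_map_gramD L e dV hdV dW hdW) (antidiagonal_over_eq_map (Fp L) L 2) Q hQ
          (toLocalFour (Fp L) L (IsCMField.complexConj L) v (weylTwo (UnitaryGroup.LocalRing L v) (UnitaryGroup.conjLocal L (IsCMField.complexConj L) v))) *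
        FrameTransport.frameConj (Fp L) L (IsCMField.complexConj L) v (2 + 2) (hermD_eq_map_gramD L e dV hdV dW hdW) (antidiagonal_over_eq_map (Fp L) L 2) Q hQ
          (toLocalFour (Fp L) L (IsCMField.complexConj L) v (weylOne (UnitaryGroup.LocalRing L v) (UnitaryGroup.conjLocal L (IsCMField.complexConj L) v))) *
        FrameTransport.frameConj (Fp L) L (IsCMField.complexConj L) v (2 + 2) (hermD_eq_map_gramD L e dV hdV dW hdW) (antidiagonal_over_eq_map (Fp L) L 2) Q hQ
          (toLocalFour (Fp L) L (IsCMField.complexConj L) v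
            (uMinus (UnitaryGroup.LocalRing L v) (UnitaryGroup.conjLocal L (IsCMField.complexConj L) v)
              (UnitaryGroup.conjLocal_conjLocal (IsCMField.complexConj L) v (complexConj_imagUnit L) (imagUnit_ne_zero L)) z)))) =
        (!![1, 0; 0, (UnitaryGroup.toLocalRing L v).comp (algebraMap (Fp L) (v.adicCompletion (Fp L))) d₁'] *
          (D.map ((UnitaryGroup.toLocalRing L v).comp (algebraMap (Fp L) (v.adicCompletion (Fp L)))) * !![0, 1; 1, 0] *
            Dinv.map ((UnitaryGroup.toLocalRing L v).comp (algebraMap (Fp L) (v.adicCompletion (Fp L)))))) *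
        (D.map ((UnitaryGroup.toLocalRing L v).comp (algebraMap (Fp L) (v.adicCompletion (Fp L)))) *
            !![1, -UnitaryGroup.conjLocal L (IsCMField.complexConj L) v z; 0, 1] *
          Dinv.map ((UnitaryGroup.toLocalRing L v).comp (algebraMap (Fp L) (v.adicCompletion (Fp L))))) := by
  haveI : Algebra.IsQuadraticExtension (Fp L) L := IsCMField.isQuadraticExtension L
  -- the three letters' blocks
  have hBm := (isSiegelDelta_flip_mul_frameConj_weylTwo (Fp L) L (IsCMField.complexConj L) (complexConj_imagUnit L) (imagUnit_ne_zero L)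
    (imagUnit_mul_self L) v (gramR_isSymm L e dV hdV dW hdW) (hermD_eq_map_gramD L e dV hdV dW hdW) D Dinv hDD Q hQm hQ hDa hDia w₁
    (hw₁.trans fromBlocks_one_sub_single_one)).2
  have hCm := blkC_matA_flip_mul_frameConj_weylTwo L e dV hdV dW hdW v D Dinv hDD Q hQm hQ hDa hDia hw₁
  have hDm := (K2LiuLocalFourCornerFrameOfRecord.blkA_blkD_flip_mul_frameConj_weylTwo (Fp L) L (IsCMField.complexConj L) v
    (hermD_eq_map_gramD L e dV hdV dW hdW) D Dinv hDD Q hQm hQ hDa hDia w₁ (hw₁.trans fromBlocks_one_sub_single_one)).2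
  have hw := K2LiuLocalFourCornerFactorisation.adapt_matA_frameConj_weylOne (Fp L) L (IsCMField.complexConj L) v (hermD_eq_map_gramD L e dV hdV dW hdW)
    D Dinv hDD Q hQm hQ
  rw [adapt_eq] at hw
  obtain ⟨-, hBw, hCw, hDw⟩ := Matrix.fromBlocks_inj.1 hw
  have hu := K2LiuLocalFourCornerFactorisation.adapt_matA_frameConj_uMinus (Fp L) L (IsCMField.complexConj L) (complexConj_imagUnit L) (imagUnit_ne_zero L) v
    (hermD_eq_map_gramD L e dV hdV dW hdW) D Dinv hDD Q hQm hQ z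
  rw [adapt_eq] at hu
  obtain ⟨-, hBu, hCu, hDu⟩ := Matrix.fromBlocks_inj.1 hu
  obtain ⟨-, hBq, hCq, hDq⟩ := levi_mul_blocks (Fp L) L (IsCMField.complexConj L) v 2 hBm hCm hBw hCw
  obtain ⟨-, -, -, hD⟩ := levi_mul_blocks (Fp L) L (IsCMField.complexConj L) v 2 hBq hCq hBu hCu
  rw [hDm, hDw] at hDq
  rw [hDq, hDu] at hD
  exact ⟨hDq, hD⟩

set_option maxHeartbeats 4000000 in -- as ★ (B1) §1 (statement elaboration + one `rw` on the doubled `LocalMp` letters)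
include hPσ hT₁ hT₂ hTv' hTv₁ hTv₂ hW₁ hW₂ hp₁ hp₂ hDD hQm hDa hDia hw₁ in
/-- **THE GRAPH READING AT THE CORNER PREFIX (operator layer, `z`-free scalar).**  With `q := (w₁ · φ(w₂)) · φ(w₁′)` and `p(z) := q · φ(u⁻(z))` there is a
Levi letter `B = B_z` (★ [A1-ζ]'s `hB` bytes at `m := frameMp_{PD} j̃(p₁, p₂)`) with, for every `Ψ` and `u`:
`(op(j̃)(frameOp⁻¹(ω(s′(p(z) ⊗ 1))(frameOp (op(j̃)⁻¹ Ψ)))))(u) = (χ_v⁻¹(det_Δ q)^{M₂})⁻¹ · |det B_z|^{-1/2} · Ψ(P̂D⁻¹ (B_z⁻¹ (P̂D u)))` — ★ (B1) §1 at `p(z)`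
(`cornerPrefix_levi`) with `chiDet_cornerPrefix`. [cite: Kudla1994, §3 Thm. 3.1] [cite: Rangarao1993, Lemma 3.2 (3.8), p. 351] [cite: MoeglinVignerasWaldspurger1987, Chap. 2 II.6] -/
theorem exists_levi_letter_cornerPrefix_apply (z : UnitaryGroup.LocalRing L v) :
    ∃ B : GL (Fin ((M₂ + M₂) + (M₂ + M₂))) (v.adicCompletion (Fp L)),
      MpPsi.proj _ (frameMp (Fp L) v ((M₂ + M₂) + (M₂ + M₂)) PD (transpose_pd_mul_gramD_mul_pd (Fp L) (M₂ + M₂) P hP hPD)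
          (boxLoc (Fp L) v M₂ M₂ (T₁ := T₁) (T₂ := T₂) (p₁, p₂))) *
        iotaD (Fp L) L (IsCMField.complexConj L) (complexConj_imagUnit L) (imagUnit_ne_zero L) (imagUnit_mul_self L) v (M₂ + M₂)
          (gramR_isSymm L e' dV hdV (tensorFrame L dW eW dV') (tensorFrame_real L dW hdW eW dV' hdV'))
          (hermD_eq_map_gramD L e' dV hdV (tensorFrame L dW eW dV') (tensorFrame_real L dW hdW eW dV' hdV'))
          (tensorEmbLoc L e dV hdV dW hdW eW e' dV' hdV' v (w₁ *
            FrameTransport.frameConj (Fp L) L (IsCMField.complexConj L) v (2 + 2) (hermD_eq_map_gramD L e dV hdV dW hdW) (antidiagonal_over_eq_map (Fp L) L 2) Q hQ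
              (toLocalFour (Fp L) L (IsCMField.complexConj L) v (weylTwo (UnitaryGroup.LocalRing L v) (UnitaryGroup.conjLocal L (IsCMField.complexConj L) v))) *
            FrameTransport.frameConj (Fp L) L (IsCMField.complexConj L) v (2 + 2) (hermD_eq_map_gramD L e dV hdV dW hdW) (antidiagonal_over_eq_map (Fp L) L 2) Q hQ
              (toLocalFour (Fp L) L (IsCMField.complexConj L) v (weylOne (UnitaryGroup.LocalRing L v) (UnitaryGroup.conjLocal L (IsCMField.complexConj L) v))) *
            FrameTransport.frameConj (Fp L) L (IsCMField.complexConj L) v (2 + 2) (hermD_eq_map_gramD L e dV hdV dW hdW) (antidiagonal_over_eq_map (Fp L) L 2) Q hQ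
              (toLocalFour (Fp L) L (IsCMField.complexConj L) v
                (uMinus (UnitaryGroup.LocalRing L v) (UnitaryGroup.conjLocal L (IsCMField.complexConj L) v)
                  (UnitaryGroup.conjLocal_conjLocal (IsCMField.complexConj L) v (complexConj_imagUnit L) (imagUnit_ne_zero L)) z)))) *
        (MpPsi.proj _ (frameMp (Fp L) v ((M₂ + M₂) + (M₂ + M₂)) PD (transpose_pd_mul_gramD_mul_pd (Fp L) (M₂ + M₂) P hP hPD)
          (boxLoc (Fp L) v M₂ M₂ (T₁ := T₁) (T₂ := T₂) (p₁, p₂))))⁻¹ =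
      transportSp (localGram (Fp L) ((M₂ + M₂) + (M₂ + M₂))
          (gramD (Fp L) (M₂ + M₂) (gramR L e' dV hdV (tensorFrame L dW eW dV') (tensorFrame_real L dW hdW eW dV' hdV'))) v)
        (isUnit_det_localGram_gramD (Fp L) v (M₂ + M₂) hT₀d) (levi B) ∧
      ∀ (Ψ : SchwartzBruhat (Fin ((M₂ + M₂) + (M₂ + M₂)) → v.adicCompletion (Fp L))) (u : Fin ((M₂ + M₂) + (M₂ + M₂)) → v.adicCompletion (Fp L)),
        ((MpPsi.toOp _ (boxLoc (Fp L) v M₂ M₂ (T₁ := T₁) (T₂ := T₂) (p₁, p₂))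
            ((frameOp (Fp L) v ((M₂ + M₂) + (M₂ + M₂)) PD).symm
              (MpPsi.toRep (localSchrodinger (Fp L) ((M₂ + M₂) + (M₂ + M₂))
                  (gramD (Fp L) (M₂ + M₂) (gramR L e' dV hdV (tensorFrame L dW eW dV') (tensorFrame_real L dW hdW eW dV' hdV'))) v)
                ((localSplittingDatumCM L v μ (M₂ + M₂)
                  (gramR_isSymm L e' dV hdV (tensorFrame L dW eW dV') (tensorFrame_real L dW hdW eW dV' hdV')) hT₀d
                  (hermD_eq_map_gramD L e' dV hdV (tensorFrame L dW eW dV') (tensorFrame_real L dW hdW eW dV' hdV')) χ hχ).localSplitting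
                  (tensorEmbLoc L e dV hdV dW hdW eW e' dV' hdV' v (w₁ *
                    FrameTransport.frameConj (Fp L) L (IsCMField.complexConj L) v (2 + 2) (hermD_eq_map_gramD L e dV hdV dW hdW)
                      (antidiagonal_over_eq_map (Fp L) L 2) Q hQ
                      (toLocalFour (Fp L) L (IsCMField.complexConj L) v
                        (weylTwo (UnitaryGroup.LocalRing L v) (UnitaryGroup.conjLocal L (IsCMField.complexConj L) v))) *
                    FrameTransport.frameConj (Fp L) L (IsCMField.complexConj L) v (2 + 2) (hermD_eq_map_gramD L e dV hdV dW hdW)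
                      (antidiagonal_over_eq_map (Fp L) L 2) Q hQ
                      (toLocalFour (Fp L) L (IsCMField.complexConj L) v
                        (weylOne (UnitaryGroup.LocalRing L v) (UnitaryGroup.conjLocal L (IsCMField.complexConj L) v))) *
                    FrameTransport.frameConj (Fp L) L (IsCMField.complexConj L) v (2 + 2) (hermD_eq_map_gramD L e dV hdV dW hdW)
                      (antidiagonal_over_eq_map (Fp L) L 2) Q hQ
                      (toLocalFour (Fp L) L (IsCMField.complexConj L) v
                        (uMinus (UnitaryGroup.LocalRing L v) (UnitaryGroup.conjLocal L (IsCMField.complexConj L) v)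
                          (UnitaryGroup.conjLocal_conjLocal (IsCMField.complexConj L) v (complexConj_imagUnit L) (imagUnit_ne_zero L)) z)))))
                ((frameOp (Fp L) v ((M₂ + M₂) + (M₂ + M₂)) PD)
                  ((MpPsi.toOp _ (boxLoc (Fp L) v M₂ M₂ (T₁ := T₁) (T₂ := T₂) (p₁, p₂))).symm Ψ)))) :
            SchwartzBruhat (Fin ((M₂ + M₂) + (M₂ + M₂)) → v.adicCompletion (Fp L))) :
          (Fin ((M₂ + M₂) + (M₂ + M₂)) → v.adicCompletion (Fp L)) → ℂ) u =
        (((LocalSplitting.chiDet (Fp L) L (IsCMField.complexConj L) v 2 (fun w' : PlacesOver L v => (χ.localComponent w'.1)⁻¹) (w₁ *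
            FrameTransport.frameConj (Fp L) L (IsCMField.complexConj L) v (2 + 2) (hermD_eq_map_gramD L e dV hdV dW hdW) (antidiagonal_over_eq_map (Fp L) L 2) Q hQ
              (toLocalFour (Fp L) L (IsCMField.complexConj L) v (weylTwo (UnitaryGroup.LocalRing L v) (UnitaryGroup.conjLocal L (IsCMField.complexConj L) v))) *
            FrameTransport.frameConj (Fp L) L (IsCMField.complexConj L) v (2 + 2) (hermD_eq_map_gramD L e dV hdV dW hdW) (antidiagonal_over_eq_map (Fp L) L 2) Q hQ
              (toLocalFour (Fp L) L (IsCMField.complexConj L) v (weylOne (UnitaryGroup.LocalRing L v) (UnitaryGroup.conjLocal L (IsCMField.complexConj L) v)))) ^ M₂)⁻¹ :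
            ℂˣ) : ℂ) *
          (((modSqrt (glEquiv B) : ℝ) : ℂ)⁻¹ *
            (Ψ : (Fin ((M₂ + M₂) + (M₂ + M₂)) → v.adicCompletion (Fp L)) → ℂ)
              ((frameLin (Fp L) v ((M₂ + M₂) + (M₂ + M₂)) PD).symm
                ((glEquiv B).symm (frameLin (Fp L) v ((M₂ + M₂) + (M₂ + M₂)) PD u)))) := by
  obtain ⟨-, hB0, hC0, -⟩ := cornerPrefix_levi L e dV hdV dW hdW v D Dinv hDD Q hQm hQ hDa hDia hw₁ z
  obtain ⟨B, hB, h⟩ := exists_levi_letter_toOp_boxLoc_localSplitting_tensorEmbLoc_apply L e dV hdV dW hdW eW e' dV' hdV' v μ χ hχ P hPσ hP hPD hT₁ hT₂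
    hT₀d hTv' hTv₁ hTv₂ p₁ hp₁ B₁ hW₁ p₂ hp₂ B₂ hW₂ _ hB0 hC0
  refine ⟨B, hB, fun Ψ u => ?_⟩
  rw [h Ψ u, chiDet_cornerPrefix L e dV hdV dW hdW v D Dinv hDD Q hQm hQ hDa hDia hw₁ _ z]


end Summit.HodgeConjecture.HodgeConjecture.Cruxes.HLiu418.K2LiuConeGraphReadingCornerPrefix

end
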